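import Summits.Ventures.YMGap.Thresholds.ZeroCouplingMomentsSUN4
import Summits.Ventures.YMGap.RobustBall.StarKernelSusceptibilityLimit
import Summits.Ventures.YMGap.RobustBall.StarKernelSusceptibilityRateExp
import Summits.Ventures.YMGap.RobustBall.HeatBathPoincareZdDLR
import Summits.Ventures.YMGap.RobustBall.LangevinPoincareDLR
import Summits.Ventures.YMGap.RobustBall.HeatBathConcentrationDLR
import Summits.Ventures.YMGap.RobustBall.HeatBathPoincareZdBallDLR
import HarnessLib

/-!
# Venture statement — YMGap (cell `pub-ymgap`) — CONJUNCT BODIES T92 (= T92a–c), T93 (= T93a–d), T94 (= T94a–e) (V23J, block 1)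

STATUS: FILED by p3 g12 as V23J = T92 (= T92a–c) + T93 (= T93a–d) + T94 (= T94a–e) on the chair's ★ R382 (lead g14, bus 2026-08-25T06:54:03Z, INBOX l.7879), quoted: «R382
— V23J: YES, same shape as V23E–V23I: V23J = T92 `T92_HaarFourthMomentsAndCumulants` (a–c, ds-1 g11 block D 61fc9f674261ce7e) + T93 `T93_SU2WilsonStarSusceptibility`
(a–d, ds-3 g15 part L 68854019d09989d5) (+ any set GREEN-by-import announced BEFORE the final-sha line); candidate 0be080451ccf8d55 (236 l) re-hashed by me = yours; owner
window to 07:55Z (silence = consent); referee pre-audit; ONE final-sha line; ONE dry-run + ONE `--kind definition --review` filing + ONE wait. SEQUENCING (v1.18 has right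
of way) …; V23J's index entry is v1.19 (combined as built), never v1.18». Owner words: rb-p2 g15 offer l.7881 (T94, explicit); ds-1 (g16) and ds-3 (g17): no correction by
the 07:55Z window (silence = consent per R382; ds-1 g16 / ds-3 g18 seated, silent on T92/T93). Referee g38 pre-audit: F-744 (T92/T93 cut 0be080451ccf8d55) + F-745 (grown
candidate cf627a812fab2fe6, 30/30 ALL-STD) CLEAN; the re-diff of THIS final is asked on the bus before the filing. Composition frozen = T92 + T93 + T94 (rb-p2's live
T-texts file has since grown to 4a216ffd3d6a1836 with rows (f)(g) — V23J keeps the v1 bytes 5f6de0c0c62036f3 of l.7881, kept by the owner as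
`T-texts-rbp2g15.v1.5f6de0c0.lean.bak`; the new rows ride the next block); this FINAL differs from the candidate 0be080451ccf8d55 in this STATUS sentence only (decl lines
identical). Numbers T92, T93, T94 assigned by p3 under lead g10's delegation (bus 2026-08-24T09:03:51Z «T-numbers (T71+) are p3's to assign»; ★ R322 (4) / ★ R324 (4);
lead g13/g14 R372 / R377 / R380 pattern: «a set GREEN after the V23I final-sha line goes to the next block») in GREEN order (first by-import `lean check` rc 0 / 0
warnings / std axioms with all parents TREE modules with built oleans; ties inside one olean batch broken by the owners' announcement order), announced on the bus before
filing: T92 — ds-1 g11 block D `HOME/ds/ds1g11/lean/V1X-CONJUNCTS-ds1g11-D.lean` 61fc9f674261ce7e (parts 19b–19e, offered 2026-08-24 with blocks A (= T74) and C (= T82);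
parent `Thresholds/ZeroCouplingMomentsSUN4` p394157 bcee83d3e37b (tree fa49c644ef92, olean 06:34Z 2026-08-25)) rc 0 at 06:5xZ; T93 — ds-3 g15 part L
`HOME/ds/ds3/lean/g15/texts/V1XConjunctsDS3g15L.lean` 68854019d09989d5 (C-KMIX-STAR steps 3–4, offered 2026-08-24 with parts H–K (K = T80); parents
`RobustBall/StarKernelSusceptibilityLimit` p391623 aa356e06bc06 (8014724c7f56, olean 04:05Z), `RobustBall/StarKernelSusceptibilityRateExp` p393709 976356352214
(76f3b25263e2, olean 06:33Z)) rc 0 at 06:5xZ; T94 — rb-p2 g15 T-texts `HOME/rb/lean-rb-p2/T-texts-rbp2g15.lean` 5f6de0c0c62036f3 (owner line bus l.7881 «T-TEXT CANDIDATES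
for V23J … your numbering/naming» = explicit consent; referee g38 by-import rc 0 06:27Z; parents `RobustBall/HeatBathPoincareZdDLR` p391414, `LangevinPoincareDLR`
p392660, `HeatBathConcentrationDLR` p392381, `HeatBathPoincareZdBallDLR` p392920 — all built) rc 0 at 07:0xZ — GROWTH announced after T92/T93, hence T94. Only decl names
change (map `RENAMES-V23J.txt`: `T_X ↦ T92x_X` / `T93x_X` / `T94x_X` with p3's consolidating conjunctions `T92_HaarFourthMomentsAndCumulants`,
`T93_SU2WilsonStarSusceptibility`, `T94_SU2GibbsStateFunctionalInequalities` in the V20B/V22/V23D style — additions, not owner bytes); ds-3's part-L file declares at the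
root with `open Summit.Ventures.YMGap …` lines (kept) and lands inside `namespace Summit.Ventures.YMGap` like every block decl; built mechanically by `mkmono23j.py` (= p2
g11's `mkmono.py`); byte-compare `bytecmp.py --map` = verbatim-modulo-map. NOT IN THIS BLOCK: the T95+ queue of `HOME/lean/STATEMENT-INDEX-0823.md` (NUMBERING T87+ line).

HONEST FRAMING. WHAT THIS IS: bodies `Tk_… : Prop` + witnesses `Tk_…_holds`, kernel-checked with NO hypothesis, closing by TREE constants only. (T92) PURE COMPACT-GROUP
INTEGRATION and EXACT `β = 0` statements: `∫_{SU(N)} |U₀₀|⁴ = 2/(N(N+1))` and `∫_{SU(N)} |tr U|⁴ = 2` (every `N ≥ 3`), `∫_{SU(N)} (Re tr U)⁴ = 3/4` (`N ≥ 3`, `N ≠ 4`) with the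
vanishing fourth cumulant of the `SU(3)` plaquette variable under Haar measure, and the identically vanishing joint fourth cumulant of `SU(3)` plaquette variables under the
infinite Haar product (`β = 0`, every `d`) — inputs of the strong-coupling expansion; nothing about `β > 0`. (T93) `SU(2)` on `ℤ⁴`, Wilson action, EVERY `0 ≤ β_W ≤ 9/25` (the
vertex-star window): the finite-volume plaquette SUSCEPTIBILITY on centred boxes (= the plaquette–plaquette covariance row sum) is bounded by ONE explicit constant for all
boxes and ALL boundary fields, converges to the infinite-volume susceptibility for EVERY sequence of boundary fields with an explicit geometric rate, and the boundary
influence on a plaquette expectation decays geometrically in the depth — finite-volume / boundary-uniform statements inside the star door; constants and the rate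
`e^{−t/16}` are door artefacts, not measured correlation lengths. (T94) `SU(2)`, EVERY infinite-volume Gibbs (DLR) state on the Kantorovich–Rubinstein window `0 ≤ β_W < 2/9`
(`d = 4`; `d = 3`: `β_W < 1/3`): the gradient-form (Langevin, `Gam`) Poincaré inequality with constant `((1 − 9β_W/2)(1 − 3β_W))⁻¹`, the Glauber (heat-bath) Poincaré inequality
with constant `(2 − 9β_W)⁻¹`, EXPONENTIAL CONCENTRATION of local Lipschitz observables (both tails `≤ e^{2/3} exp(−r/√(2(2 − 9β_W)⁻¹ Σδ²))`), and the heat-bath Poincaré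
inequality of every DLR state of every member of the `ℤ^d` ball — lattice functional inequalities at strong coupling; «gap» = Poincaré constant⁻¹, no dynamics object is
constructed; uniqueness on the window is known (star door) but not used. Nothing here is about `β → ∞`, the crossover couplings, a continuum limit, a physical-units mass gap
or the Yang–Mills Millennium problem.
-/

noncomputable section

namespace Summit.Ventures.YMGap

/-! ### OWNER FILE `owners/V1X-CONJUNCTS-ds1g11-D.lean` (sha16 61fc9f674261ce7e) — section `V23J_ds1_HaarFourthCumulants` -/
section V23J_ds1_HaarFourthCumulants

/-!
# v1.x conjunct CANDIDATE texts for p3 (ds-1 g11, block D = parts 19a–19e: `SU(N)` Haar moments of bidegree (2,2) and the `β = 0`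
# fourth-order Wick structure; 19a IN THE TREE (p383306 dbac0355bee8), 19b–e staged) — NOT a proposal. All HYPOTHESIS-FREE.
HONEST FRAMING: pure compact-group integration and exact `β = 0` lattice statements; nothing about `β > 0`, the continuum or Clay.
-/


open MeasureTheory ProbabilityTheory Set
open Literature.MathematicalPhysics.QuantumLattice
open Literature.MathematicalPhysics.QuantumFieldTheory hiding ZdEdge Site


/-- HAAR-(2,2) (every `SU(N)`, `N ≥ 3`): `∫_{SU(N)} |U₀₀|⁴ dU = 2/(N(N+1))` and `∫_{SU(N)} |tr U|⁴ dU = 2` — the second Weingarten value and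
the Gaussian fourth moment of the fundamental character, by invariance alone. -/
def T92a_SUNHaarFourthMoments : Prop :=
  ∀ (N : ℕ) (hN : 3 ≤ N),
    (∫ U, Complex.normSq ((U : Matrix (Fin N) (Fin N) ℂ) ⟨0, by omega⟩ ⟨0, by omega⟩) ^ 2
        ∂haarProbability (Matrix.specialUnitaryGroup (Fin N) ℂ) = 2 / ((N : ℝ) * (N + 1))) ∧
    (∫ U, Complex.normSq (U : Matrix (Fin N) (Fin N) ℂ).trace ^ 2 ∂haarProbability (Matrix.specialUnitaryGroup (Fin N) ℂ) = 2)

/-- Proof of `T92a_SUNHaarFourthMoments`. -/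
theorem T92a_SUNHaarFourthMoments_holds : T92a_SUNHaarFourthMoments :=
  fun _ hN => ⟨HaarFourthMomentSUN.integral_normSq_sq_suN hN, HaarFourthMomentSUN.integral_normSq_trace_sq_suN hN⟩

/-- HAAR-4′ (`SU(N)`, `N ≥ 3`, `N ≠ 4`): `∫_{SU(N)} (Re tr U)⁴ dU = 3/4`; for `SU(3)` the fourth cumulant of the plaquette variable
`W = (1/3) Re tr U` under Haar measure vanishes: `∫ W⁴ − 3 (∫ W²)² = 0`. -/
def T92b_SUNCharacterFourthCumulant : Prop :=
  (∀ N : ℕ, 3 ≤ N → N ≠ 4 →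
    ∫ U, ((U : Matrix (Fin N) (Fin N) ℂ).trace.re) ^ 4 ∂haarProbability (Matrix.specialUnitaryGroup (Fin N) ℂ) = 3 / 4) ∧
  ((∫ U, ((3 : ℝ)⁻¹ * (U : Matrix (Fin 3) (Fin 3) ℂ).trace.re) ^ 4 ∂haarProbability (Matrix.specialUnitaryGroup (Fin 3) ℂ)) -
      3 * (∫ U, ((3 : ℝ)⁻¹ * (U : Matrix (Fin 3) (Fin 3) ℂ).trace.re) ^ 2
        ∂haarProbability (Matrix.specialUnitaryGroup (Fin 3) ℂ)) ^ 2 = 0)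

/-- Proof of `T92b_SUNCharacterFourthCumulant`. -/
theorem T92b_SUNCharacterFourthCumulant_holds : T92b_SUNCharacterFourthCumulant :=
  ⟨fun _ hN hN4 => HaarFourthMomentSUN.integral_reTr_pow_four_suN hN hN4,
    HaarFourthMomentSUN.su3_fourthCumulant_plaquetteVariable_eq_zero⟩

/-- C-PRESS-0 (`SU(3)`, every `d`): at `β = 0` (the infinite Haar product) the joint fourth cumulant of the plaquette variables
`W_p = (1/3) Re tr U_p` vanishes identically: `E[W_aW_bW_cW_e] − E[W_aW_b]E[W_cW_e] − E[W_aW_c]E[W_bW_e] − E[W_aW_e]E[W_bW_c] = 0`. -/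
def T92c_SU3ZeroCouplingFourthCumulant : Prop :=
  ∀ (d : ℕ) (a b c e : ZdPlaquette d),
    ∫ U, zdPlaquetteObs (fundamentalRep (Fin 3)) a.1 a.2.1.1 a.2.1.2 U * zdPlaquetteObs (fundamentalRep (Fin 3)) b.1 b.2.1.1 b.2.1.2 U *
          zdPlaquetteObs (fundamentalRep (Fin 3)) c.1 c.2.1.1 c.2.1.2 U * zdPlaquetteObs (fundamentalRep (Fin 3)) e.1 e.2.1.1 e.2.1.2 U
          ∂zdHaar d (Matrix.specialUnitaryGroup (Fin 3) ℂ) -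
        (∫ U, zdPlaquetteObs (fundamentalRep (Fin 3)) a.1 a.2.1.1 a.2.1.2 U *
          zdPlaquetteObs (fundamentalRep (Fin 3)) b.1 b.2.1.1 b.2.1.2 U ∂zdHaar d (Matrix.specialUnitaryGroup (Fin 3) ℂ)) *
        (∫ U, zdPlaquetteObs (fundamentalRep (Fin 3)) c.1 c.2.1.1 c.2.1.2 U *
          zdPlaquetteObs (fundamentalRep (Fin 3)) e.1 e.2.1.1 e.2.1.2 U ∂zdHaar d (Matrix.specialUnitaryGroup (Fin 3) ℂ)) -
        (∫ U, zdPlaquetteObs (fundamentalRep (Fin 3)) a.1 a.2.1.1 a.2.1.2 U *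
          zdPlaquetteObs (fundamentalRep (Fin 3)) c.1 c.2.1.1 c.2.1.2 U ∂zdHaar d (Matrix.specialUnitaryGroup (Fin 3) ℂ)) *
        (∫ U, zdPlaquetteObs (fundamentalRep (Fin 3)) b.1 b.2.1.1 b.2.1.2 U *
          zdPlaquetteObs (fundamentalRep (Fin 3)) e.1 e.2.1.1 e.2.1.2 U ∂zdHaar d (Matrix.specialUnitaryGroup (Fin 3) ℂ)) -
        (∫ U, zdPlaquetteObs (fundamentalRep (Fin 3)) a.1 a.2.1.1 a.2.1.2 U *
          zdPlaquetteObs (fundamentalRep (Fin 3)) e.1 e.2.1.1 e.2.1.2 U ∂zdHaar d (Matrix.specialUnitaryGroup (Fin 3) ℂ)) *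
        (∫ U, zdPlaquetteObs (fundamentalRep (Fin 3)) b.1 b.2.1.1 b.2.1.2 U *
          zdPlaquetteObs (fundamentalRep (Fin 3)) c.1 c.2.1.1 c.2.1.2 U ∂zdHaar d (Matrix.specialUnitaryGroup (Fin 3) ℂ)) = 0

/-- Proof of `T92c_SU3ZeroCouplingFourthCumulant`. -/
theorem T92c_SU3ZeroCouplingFourthCumulant_holds : T92c_SU3ZeroCouplingFourthCumulant :=
  fun _ a b c e => ZeroCouplingMoments.su3_fourthCumulant_zdHaar a b c e

end V23J_ds1_HaarFourthCumulants

/-! ### OWNER FILE `owners/V1XConjunctsDS3g15L.lean` (sha16 68854019d09989d5) — section `V23J_ds3_StarSusceptibility` -/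
section V23J_ds3_StarSusceptibility

/-!
Statement v1.x candidate conjuncts from ds-3's gen-15 files, PART L (TEXT for the p2/p3 seats; checkable once
`RobustBall/StarKernelSusceptibility.lean`, `RobustBall/StarKernelSusceptibilityLimit.lean` `RobustBall/StarKernelSusceptibilityRate.lean` and `RobustBall/StarKernelSusceptibilityRateExp.lean` are IN THE TREE; NOT proposed by ds-3).
Track DS, currency C-KMIX-STAR steps 3–4: THE FINITE-VOLUME PLAQUETTE SUSCEPTIBILITY ON CENTRED BOXES — bounded by ONE constant for all
boxes and ALL boundary fields, and convergent to the infinite-volume susceptibility for EVERY sequence of boundary fields — `SU(2)` on `ℤ⁴`,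
Wilson action, EVERY `0 ≤ β_W ≤ 9/25`. HONEST LABEL: strong-coupling LATTICE statements; «susceptibility» = the plaquette–plaquette
covariance row sum; nothing continuum.
-/

open MeasureTheory Filter Topology ProbabilityTheory
open scoped NNReal
open Literature.Probability.LatticeModels hiding configShift configShift_apply
open Literature.MathematicalPhysics.QuantumLattice (fundamentalRep ZdEdge LGConfig ymSpecification ymGibbsMeasures ZdPlaquette)
open Literature.MathematicalPhysics.QuantumFieldTheory (zdPlaquetteObs IsLipschitzCylinder)
open Summit.Ventures.YMGap
open Summit.Ventures.YMGap.DSWindowZd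
open Summit.Ventures.YMGap.StarWindowGauge (gaugeR)
open Summit.Ventures.YMGap.RobustBall

/-- **T93a_SU2WilsonKernelSusceptibilityStar — `SU(2)` LATTICE YANG–MILLS ON `ℤ⁴`, EVERY `0 ≤ β_W ≤ 9/25`** (tree bare coupling `β_W/2`):
for every box `M > P`, EVERY boundary field `η` and every plaquette `p` based in `box 4 P`:
`Σ_{q based in box M} |cov_{γ_{box M}(·|η)}(W_p, W_q)| ≤ 262144 · e^{t(P/2+3/2)} · 6 · ((1 + e^{−t/16})/(1 − e^{−t/16}))⁴`,
`t = −log max(R_G(β_W), ½)` — ONE constant for all boxes and all boundary fields (`RobustBall.su2_wilson_kernel_susceptibility_star_box`). -/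
def T93a_SU2WilsonKernelSusceptibilityStar : Prop :=
  ∀ βW : ℝ, 0 ≤ βW → βW ≤ 9 / 25 → ∀ (M P : ℕ), P < M →
    ∀ (η : LGConfig 4 (Matrix.specialUnitaryGroup (Fin 2) ℂ)) (p : ZdPlaquette 4), p.1 ∈ box 4 P →
      ∑ q ∈ (box 4 M) ×ˢ (Finset.univ : Finset {o : Fin 4 × Fin 4 // o.1 < o.2}),
        |cov[zdPlaquetteObs (fundamentalRep (Fin 2)) p.1 p.2.1.1 p.2.1.2,
          zdPlaquetteObs (fundamentalRep (Fin 2)) q.1 q.2.1.1 q.2.1.2;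
          ymSpecification (d := 4) (fundamentalRep (Fin 2)) (βW / 2) ((box 4 M) ×ˢ (Finset.univ : Finset (Fin 4))) η]| ≤
        262144 * Real.exp (-Real.log (max (gaugeR βW) (1 / 2)) * (P / 2 + 3 / 2)) *
          (6 * ((1 + Real.exp (-(-Real.log (max (gaugeR βW) (1 / 2)) / 16))) /
            (1 - Real.exp (-(-Real.log (max (gaugeR βW) (1 / 2)) / 16)))) ^ 4)

/-- T93a_SU2WilsonKernelSusceptibilityStar holds. -/
theorem T93a_SU2WilsonKernelSusceptibilityStar_holds : T93a_SU2WilsonKernelSusceptibilityStar :=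
  fun _ h0 h _ _ hPM η _ hp => su2_wilson_kernel_susceptibility_star_box h0 h hPM η hp

/-- **T93b_SU2WilsonKernelSusceptibilityStarLimit — `SU(2)` LATTICE YANG–MILLS ON `ℤ⁴`, EVERY `0 ≤ β_W ≤ 9/25`**: the DLR states form a
singleton `{μ}` and for EVERY sequence of boundary fields `η_M` and every plaquette `p` the finite-volume susceptibility on the centred boxes
converges to the absolutely summable infinite-volume susceptibility:
`Σ_{q based in box M} cov_{γ_{box M}(·|η_M)}(W_p, W_q) → Σ_q cov_μ(W_p, W_q)` (`RobustBall.su2_wilson_kernel_susceptibility_star_tendsto`). -/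
def T93b_SU2WilsonKernelSusceptibilityStarLimit : Prop :=
  ∀ βW : ℝ, 0 ≤ βW → βW ≤ 9 / 25 →
    ∃ μ : Measure (LGConfig 4 (Matrix.specialUnitaryGroup (Fin 2) ℂ)),
      ymGibbsMeasures (d := 4) (fundamentalRep (Fin 2)) (βW / 2) = {μ} ∧
      ∀ (ηs : ℕ → LGConfig 4 (Matrix.specialUnitaryGroup (Fin 2) ℂ)) (p : ZdPlaquette 4),
        (Summable fun q : ZdPlaquette 4 =>
            cov[zdPlaquetteObs (fundamentalRep (Fin 2)) p.1 p.2.1.1 p.2.1.2,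
              zdPlaquetteObs (fundamentalRep (Fin 2)) q.1 q.2.1.1 q.2.1.2; μ]) ∧
        Tendsto (fun M : ℕ => ∑ q ∈ (box 4 M) ×ˢ (Finset.univ : Finset {o : Fin 4 × Fin 4 // o.1 < o.2}),
            cov[zdPlaquetteObs (fundamentalRep (Fin 2)) p.1 p.2.1.1 p.2.1.2,
              zdPlaquetteObs (fundamentalRep (Fin 2)) q.1 q.2.1.1 q.2.1.2;
              ymSpecification (d := 4) (fundamentalRep (Fin 2)) (βW / 2)
                ((box 4 M) ×ˢ (Finset.univ : Finset (Fin 4))) (ηs M)]) atTop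
          (𝓝 (∑' q : ZdPlaquette 4, cov[zdPlaquetteObs (fundamentalRep (Fin 2)) p.1 p.2.1.1 p.2.1.2,
              zdPlaquetteObs (fundamentalRep (Fin 2)) q.1 q.2.1.1 q.2.1.2; μ]))

/-- T93b_SU2WilsonKernelSusceptibilityStarLimit holds. -/
theorem T93b_SU2WilsonKernelSusceptibilityStarLimit_holds : T93b_SU2WilsonKernelSusceptibilityStarLimit :=
  fun _ h0 h => su2_wilson_kernel_susceptibility_star_tendsto h0 h

/-- **T93c_SU2WilsonKernelSusceptibilityStarRate — `SU(2)` LATTICE YANG–MILLS ON `ℤ⁴`, EVERY `0 ≤ β_W ≤ 9/25`**: for every `P` there are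
`A ≥ 0` and `0 < θ < 1` such that for every box `M > P`, EVERY boundary field `η` and every plaquette `p` based in `box 4 P` the finite-volume
susceptibility is within `A · θ^M` of the infinite-volume one:
`|Σ_{q based in box M} cov_{γ_{box M}(·|η)}(W_p, W_q) − Σ_q cov_μ(W_p, W_q)| ≤ A · θ^M`
(`RobustBall.su2_wilson_kernel_susceptibility_star_rate_geometric`; explicit form in `su2_wilson_kernel_susceptibility_star_rate`). -/
def T93c_SU2WilsonKernelSusceptibilityStarRate : Prop :=
  ∀ βW : ℝ, 0 ≤ βW → βW ≤ 9 / 25 → ∀ P : ℕ,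
    ∃ μ : Measure (LGConfig 4 (Matrix.specialUnitaryGroup (Fin 2) ℂ)), ∃ A θ : ℝ,
      ymGibbsMeasures (d := 4) (fundamentalRep (Fin 2)) (βW / 2) = {μ} ∧ 0 ≤ A ∧ 0 < θ ∧ θ < 1 ∧
      ∀ M : ℕ, P < M → ∀ (η : LGConfig 4 (Matrix.specialUnitaryGroup (Fin 2) ℂ)) (p : ZdPlaquette 4), p.1 ∈ box 4 P →
        |(∑ q ∈ (box 4 M) ×ˢ (Finset.univ : Finset {o : Fin 4 × Fin 4 // o.1 < o.2}),
            cov[zdPlaquetteObs (fundamentalRep (Fin 2)) p.1 p.2.1.1 p.2.1.2,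
              zdPlaquetteObs (fundamentalRep (Fin 2)) q.1 q.2.1.1 q.2.1.2;
              ymSpecification (d := 4) (fundamentalRep (Fin 2)) (βW / 2)
                ((box 4 M) ×ˢ (Finset.univ : Finset (Fin 4))) η]) -
            ∑' q : ZdPlaquette 4, cov[zdPlaquetteObs (fundamentalRep (Fin 2)) p.1 p.2.1.1 p.2.1.2,
              zdPlaquetteObs (fundamentalRep (Fin 2)) q.1 q.2.1.1 q.2.1.2; μ]| ≤ A * θ ^ M

/-- T93c_SU2WilsonKernelSusceptibilityStarRate holds. -/
theorem T93c_SU2WilsonKernelSusceptibilityStarRate_holds : T93c_SU2WilsonKernelSusceptibilityStarRate :=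
  fun _ h0 h P => su2_wilson_kernel_susceptibility_star_rate_geometric h0 h P

/-- **T93d_SU2WilsonBoundaryStarGeometric — `SU(2)` LATTICE YANG–MILLS ON `ℤ⁴`, EVERY `0 ≤ β_W ≤ 9/25`** (tree bare coupling `β_W/2`): for every finite
link volume `Λ₀`, EVERY boundary field `η`, EVERY DLR state `μ`, every depth function `φ` of `Λ₀` and every Lipschitz cylinder `F` (constant `K`, links
`Δ ⊆ Λ₀` with `φ ≥ m` on `Δ`): `|∫F dγ_{Λ₀}(·|η) − ∫F dμ| ≤ 2√2 · K · #Δ · R_G(β_W)^{⌊m/4⌋}` — the GEOMETRIC-rate sharpening of text J's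
`T_SU2WilsonBoundaryStar` (`RobustBall.su2_wilson_boundary_star_geometric`). -/
def T93d_SU2WilsonBoundaryStarGeometric : Prop :=
  ∀ βW : ℝ, 0 ≤ βW → βW ≤ 9 / 25 →
    ∀ (μ : Measure (LGConfig 4 (Matrix.specialUnitaryGroup (Fin 2) ℂ))),
      μ ∈ ymGibbsMeasures (d := 4) (fundamentalRep (Fin 2)) (βW / 2) →
    ∀ (Λ₀ : Finset (ZdEdge 4)) (η : LGConfig 4 (Matrix.specialUnitaryGroup (Fin 2) ℂ)) (φ : ZdEdge 4 → ℝ),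
      (∀ x y : ZdEdge 4, φ x ≤ φ y + ‖x.1 - y.1‖) → (∀ x, 0 < φ x → x ∈ Λ₀) →
    ∀ (F : LGConfig 4 (Matrix.specialUnitaryGroup (Fin 2) ℂ) → ℝ) (Δ : Finset (ZdEdge 4)) (K : ℝ≥0) (m : ℝ),
      IsLipschitzCylinder (fundamentalRep (Fin 2)) F Δ K → Δ ⊆ Λ₀ → (∀ x ∈ Δ, m ≤ φ x) →
      |(∫ U, F U ∂(ymSpecification (d := 4) (fundamentalRep (Fin 2)) (βW / 2) Λ₀ η)) - ∫ U, F U ∂μ| ≤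
        2 * Real.sqrt 2 * K * Δ.card * gaugeR βW ^ ⌊m / (4 : ℕ)⌋₊

/-- T93d_SU2WilsonBoundaryStarGeometric holds. -/
theorem T93d_SU2WilsonBoundaryStarGeometric_holds : T93d_SU2WilsonBoundaryStarGeometric :=
  fun _ h0 h _ hμ Λ₀ η φ hφ hφΛ _ _ _ _ hF hΔ hm => su2_wilson_boundary_star_geometric h0 h hμ Λ₀ η φ hφ hφΛ hF hΔ hm

end V23J_ds3_StarSusceptibility

/-! ### OWNER FILE `owners/T-texts-rbp2g15.lean` (sha16 5f6de0c0c62036f3) — section `V23J_rbp2_GibbsStateInequalities` -/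
section V23J_rbp2_GibbsStateInequalities

/-!
# Venture YMGap — candidate statement conjuncts (T-texts) for the GIBBS-STATE (DLR) corner of rb-p2's Poincaré / concentration column (g12/g14 landings)

HONEST FRAMING: universal closures, VERBATIM over tree theorems (all four parents IN THE TREE at the time of writing: `HeatBathPoincareZdDLR` p391414,
`LangevinPoincareDLR` p392660, `HeatBathConcentrationDLR` p392381, `HeatBathPoincareZdBallDLR` p392920), of the GLAUBER (heat-bath) and LANGEVIN
(gradient-form, `LatticeBakryEmery.Gam`) Poincaré inequalities and the EXPONENTIAL CONCENTRATION of local Lipschitz observables in EVERY infinite-volume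
Gibbs (DLR) state of strong-coupling `SU(2)` lattice Yang–Mills on `ℤ⁴` (Kantorovich–Rubinstein window `0 ≤ β_W < 2/9`; `d = 3`: `β_W < 1/3`), and of the
heat-bath Poincaré inequality of every DLR state of every member of the `ℤ^d` ball (per-link loads, one constant for the ball).  LATTICE statements at strong
coupling; «gap ≥ K» means a Poincaré inequality with constant `K⁻¹` (no dynamics object is constructed); uniqueness of the DLR state on the window is known in
the tree (star door) but NOT used; nothing about `β → ∞`, the continuum or Clay.  Each `_holds` closes by tree constants only.  DRAFT for p3 / rb-theory
(naming and numbering are theirs); not proposed by rb-p2.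
-/


open scoped ContDiff Matrix.Norms.Frobenius NNReal
open MeasureTheory ProbabilityTheory Function Finset
open Literature.Probability.LatticeModels Literature.Probability.LatticeModels.DobrushinMetric
open Literature.MathematicalPhysics.QuantumLattice hiding torusNorm
open Literature.MathematicalPhysics.QuantumFieldTheory hiding ZdEdge
open Summit.Ventures.YMGap.LatticeBakryEmery


/-- CANDIDATE T-text ★★★ «THE LANGEVIN POINCARÉ INEQUALITY OF EVERY INFINITE-VOLUME GIBBS STATE, SU(2), d = 4, every `0 ≤ β_W < 2/9`» (IN THE TREE:
`RobustBall.LangevinPoincare.su2_gibbs_variance_le_integral_Gam`): for EVERY DLR state `μ` of 4D `SU(2)` lattice Yang–Mills at tree coupling `β_W/2`, every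
finite link set `Δ` and every smooth `f` of the link matrices over `Δ`, `Var_μ(f((U_e)_{e∈Δ})) ≤ ((1 − 9β_W/2)(1 − 3β_W))⁻¹ ∫ Γ(f,f) dμ`. [folklore] -/
def T94a_SU2GibbsLangevinPoincareKR : Prop :=
  ∀ βW : ℝ, 0 ≤ βW → βW < 2 / 9 → ∀ μ : Measure (LGConfig 4 (Matrix.specialUnitaryGroup (Fin 2) ℂ)),
    μ ∈ ymGibbsMeasures (d := 4) (fundamentalRep (Fin 2)) (βW / 2) → ∀ (Δ : Finset (ZdEdge 4)) (f : Cfg ↥Δ 2 → ℝ), ContDiff ℝ ∞ f →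
      Var[matrixCylinder Δ f; μ] ≤
        ((1 - 9 * βW / 2) * (1 - 3 * βW))⁻¹ * ∫ U, Gam f f (fun e : ↥Δ => (U e : Matrix (Fin 2) (Fin 2) ℂ)) ∂μ

/-- `T94a_SU2GibbsLangevinPoincareKR` holds. [folklore] -/
theorem T94a_SU2GibbsLangevinPoincareKR_holds : T94a_SU2GibbsLangevinPoincareKR := fun _ h0 h _ hμ Δ _ hf =>
  RobustBall.LangevinPoincare.su2_gibbs_variance_le_integral_Gam h0 h hμ Δ hf

/-- CANDIDATE T-text ★★ «THE LANGEVIN POINCARÉ INEQUALITY OF EVERY INFINITE-VOLUME GIBBS STATE, SU(2), d = 3, every `0 ≤ β_W < 1/3`» (IN THE TREE: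
`RobustBall.LangevinPoincare.su2_gibbs_variance_le_integral_Gam_dim3`): `Var_μ(f((U_e)_{e∈Δ})) ≤ ((1 − 3β_W)(1 − 2β_W))⁻¹ ∫ Γ(f,f) dμ` for EVERY DLR state
`μ` of 3D `SU(2)` lattice Yang–Mills at tree coupling `β_W/2`. [folklore] -/
def T94b_SU2GibbsLangevinPoincareDim3 : Prop :=
  ∀ βW : ℝ, 0 ≤ βW → βW < 1 / 3 → ∀ μ : Measure (LGConfig 3 (Matrix.specialUnitaryGroup (Fin 2) ℂ)),
    μ ∈ ymGibbsMeasures (d := 3) (fundamentalRep (Fin 2)) (βW / 2) → ∀ (Δ : Finset (ZdEdge 3)) (f : Cfg ↥Δ 2 → ℝ), ContDiff ℝ ∞ f →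
      Var[matrixCylinder Δ f; μ] ≤
        ((1 - 3 * βW) * (1 - 2 * βW))⁻¹ * ∫ U, Gam f f (fun e : ↥Δ => (U e : Matrix (Fin 2) (Fin 2) ℂ)) ∂μ

/-- `T94b_SU2GibbsLangevinPoincareDim3` holds. [folklore] -/
theorem T94b_SU2GibbsLangevinPoincareDim3_holds : T94b_SU2GibbsLangevinPoincareDim3 := fun _ h0 h _ hμ Δ _ hf =>
  RobustBall.LangevinPoincare.su2_gibbs_variance_le_integral_Gam_dim3 h0 h hμ Δ hf

/-- CANDIDATE T-text ★★★ «THE GLAUBER (HEAT-BATH) POINCARÉ INEQUALITY OF EVERY INFINITE-VOLUME GIBBS STATE, SU(2), d = 4, every `0 ≤ β_W < 2/9`» (IN THE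
TREE: `RobustBall.HeatBathPoincareZd.su2_gibbsVariance_le_heatBath`): for EVERY DLR state `μ` at tree coupling `β_W/2` and every Lipschitz cylinder observable `F`
on the finite link set `Δ`, `Var_μ(F) ≤ (2 − 9β_W)⁻¹ ∑_{x∈Δ} ∫∫ (F(U) − F(U[x ↦ g]))² ν^U_x(dg) μ(dU)`, `ν^U_x` the one-link heat-bath law — infinite-volume heat-bath
spectral gap `≥ 1 − 9β_W/2` in every Gibbs state (standard reading). [folklore] -/
def T94c_SU2GibbsGlauberPoincareKR : Prop :=
  ∀ βW : ℝ, 0 ≤ βW → βW < 2 / 9 → ∀ μ : Measure (LGConfig 4 (Matrix.specialUnitaryGroup (Fin 2) ℂ)),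
    μ ∈ ymGibbsMeasures (d := 4) (fundamentalRep (Fin 2)) (βW / 2) →
      ∀ (F : LGConfig 4 (Matrix.specialUnitaryGroup (Fin 2) ℂ) → ℝ) (Δ : Finset (ZdEdge 4)) (KF : ℝ≥0),
        IsLipschitzCylinder (fundamentalRep (Fin 2)) F Δ KF →
          ProbabilityTheory.variance F μ ≤
            (2 - 9 * βW)⁻¹ * ∑ x ∈ Δ, ∫ U, ∫ g, (F U - F (update U x g)) ^ 2
              ∂((haarProbability (Matrix.specialUnitaryGroup (Fin 2) ℂ)).tilted
                fun g => -(βW / 2) * wilsonBoundaryAction (fundamentalRep (Fin 2)) {x} (update U x g)) ∂μ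

/-- `T94c_SU2GibbsGlauberPoincareKR` holds. [folklore] -/
theorem T94c_SU2GibbsGlauberPoincareKR_holds : T94c_SU2GibbsGlauberPoincareKR := fun _ h0 h _ hμ _ _ _ hF =>
  RobustBall.HeatBathPoincareZd.su2_gibbsVariance_le_heatBath h0 h hμ hF

/-- CANDIDATE T-text ★★★ «EXPONENTIAL CONCENTRATION OF LOCAL OBSERVABLES IN EVERY INFINITE-VOLUME GIBBS STATE, SU(2), d = 4, every `0 ≤ β_W < 2/9`» (IN THE
TREE: `RobustBall.HeatBathConcentration.su2_gibbs_measureReal_deviation_ge_le` / `…_le_le`): for EVERY DLR state `μ` at tree coupling `β_W/2`, every Lipschitz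
cylinder `F` on `Δ` with link oscillations `|F(U) − F(U[x ↦ s])| ≤ δ_x` (`∑_{x∈Δ} δ_x² > 0`) and every `r`, BOTH tails
`μ{F − E_μF ≥ r}, μ{F − E_μF ≤ −r} ≤ e^{2/3} exp(−r / √(2(2 − 9β_W)⁻¹ ∑_{x∈Δ} δ_x²))`. [folklore] -/
def T94d_SU2GibbsExponentialConcentrationKR : Prop :=
  ∀ βW : ℝ, 0 ≤ βW → βW < 2 / 9 → ∀ μ : Measure (LGConfig 4 (Matrix.specialUnitaryGroup (Fin 2) ℂ)),
    μ ∈ ymGibbsMeasures (d := 4) (fundamentalRep (Fin 2)) (βW / 2) →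
      ∀ (F : LGConfig 4 (Matrix.specialUnitaryGroup (Fin 2) ℂ) → ℝ) (Δ : Finset (ZdEdge 4)) (KF : ℝ≥0),
        IsLipschitzCylinder (fundamentalRep (Fin 2)) F Δ KF → ∀ δ : ZdEdge 4 → ℝ,
          (∀ x ∈ Δ, ∀ U s, |F U - F (update U x s)| ≤ δ x) → 0 < ∑ x ∈ Δ, δ x ^ 2 → ∀ r : ℝ,
            μ.real {U | r ≤ F U - ∫ U', F U' ∂μ} ≤
                Real.exp (2 / 3) * Real.exp (-r / Real.sqrt (2 * (2 - 9 * βW)⁻¹ * ∑ x ∈ Δ, δ x ^ 2)) ∧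
              μ.real {U | F U - ∫ U', F U' ∂μ ≤ -r} ≤
                Real.exp (2 / 3) * Real.exp (-r / Real.sqrt (2 * (2 - 9 * βW)⁻¹ * ∑ x ∈ Δ, δ x ^ 2))

/-- `T94d_SU2GibbsExponentialConcentrationKR` holds. [folklore] -/
theorem T94d_SU2GibbsExponentialConcentrationKR_holds : T94d_SU2GibbsExponentialConcentrationKR :=
  fun _ h0 h _ hμ _ _ _ hF δ hδ hD r =>
    ⟨RobustBall.HeatBathConcentration.su2_gibbs_measureReal_deviation_ge_le h0 h hμ hF δ hδ hD r,
      RobustBall.HeatBathConcentration.su2_gibbs_measureReal_deviation_le_le h0 h hμ hF δ hδ hD r⟩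

/-- CANDIDATE T-text ★★ «THE GLAUBER POINCARÉ INEQUALITY OF EVERY GIBBS STATE OF EVERY MEMBER OF THE `ℤ^d` BALL, SU(2), every d, quarter modulus» (IN THE TREE:
`RobustBall.HeatBathPoincareZd.su2_gibbsVariance_le_onBall_quarter`): for `(d−1)β_W/2 ≤ 1`, a member `W` (continuous own-link terms, support `supp` of range `R`,
per-link loads: oscillation `a`, self-Lipschitz `ℓ_s ≥ 0`, row `Λ`, column `Λc`) with column condition `(3/2)(d−1)β_W e^{a}(1 + 2√2 ℓ_s) + √2 Λc ≤ c < 1` and row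
condition `(3/2)(d−1)β_W e^{a}(1 + 2√2 ℓ_s) + √2 Λ < 1`, EVERY DLR state `μ ∈ 𝒢(γ^W)` at tree coupling `β_W/2` and every Lipschitz cylinder `F` on `Δ` satisfy
`Var_μ(F) ≤ (2(1−c))⁻¹ ∑_{x∈Δ} ∫∫ (F(U) − F(σ))² γ^W_{x}(dσ|U) μ(dU)` — ONE constant for the whole ball. [folklore] -/
def T94e_SU2GibbsGlauberPoincareOnBallZd : Prop :=
  ∀ (d : ℕ), 1 ≤ d → ∀ βW a ℓs Λ Λc R c : ℝ, 0 ≤ βW → ((d : ℝ) - 1) * βW / 2 ≤ 1 → 0 ≤ ℓs →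
    ∀ (W : Potential (ZdEdge d) (Matrix.specialUnitaryGroup (Fin 2) ℂ)), (∀ X, Continuous (W X)) →
      (∀ X, DependsOn (W X) (↑X : Set (ZdEdge d))) →
    ∀ supp : Finset (ZdEdge d) → Finset (Finset (ZdEdge d)), W.IsSupportedBy supp →
    ∀ osc : Finset (ZdEdge d) → ZdEdge d → ℝ, (∀ X, Dobrushin.IsOscBound (W X) (osc X)) →
      (∀ e, ∑ X ∈ (supp {e}).filter (fun X => e ∈ X), osc X e ≤ a) →
    ∀ lip : Finset (ZdEdge d) → ZdEdge d → ℝ, (∀ X, IsLipBound suFrobDist (W X) (lip X)) →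
      (∀ e, ∑ X ∈ (supp {e}).filter (fun X => e ∈ X), lip X e ≤ ℓs) →
      (∀ e, ∑ y ∈ RobustBall.perturbedNbr supp e, ∑ X ∈ (supp {e}).filter (fun X => e ∈ X), lip X y ≤ Λ) →
      (∀ (y : ZdEdge d) (T : Finset (ZdEdge d)), y ∉ T → ∑ e ∈ T, ∑ X ∈ (supp {e}).filter (fun X => e ∈ X), lip X y ≤ Λc) →
      (∀ e, ∀ X ∈ supp {e}, e ∈ X → ∀ y ∈ X, ‖e.1 - y.1‖ ≤ R) →
    3 / 2 * ((d : ℝ) - 1) * βW * (Real.exp a * (1 + 2 * Real.sqrt 2 * ℓs)) + Real.sqrt 2 * Λc ≤ c → c < 1 →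
    3 / 2 * ((d : ℝ) - 1) * βW * (Real.exp a * (1 + 2 * Real.sqrt 2 * ℓs)) + Real.sqrt 2 * Λ < 1 →
    ∀ μ : Measure (LGConfig d (Matrix.specialUnitaryGroup (Fin 2) ℂ)),
      μ ∈ RobustBall.perturbedGibbsMeasures (d := d) (fundamentalRep (Fin 2)) (βW / 2) W supp →
      ∀ (F : LGConfig d (Matrix.specialUnitaryGroup (Fin 2) ℂ) → ℝ) (Δ : Finset (ZdEdge d)) (KF : ℝ≥0),
        IsLipschitzCylinder (fundamentalRep (Fin 2)) F Δ KF →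
          ProbabilityTheory.variance F μ ≤
            (2 * (1 - c))⁻¹ * ∑ x ∈ Δ, ∫ U, ∫ σ, (F U - F σ) ^ 2 ∂(RobustBall.perturbedYM (fundamentalRep (Fin 2)) (βW / 2) W supp {x} U) ∂μ

/-- `T94e_SU2GibbsGlauberPoincareOnBallZd` holds. [folklore] -/
theorem T94e_SU2GibbsGlauberPoincareOnBallZd_holds : T94e_SU2GibbsGlauberPoincareOnBallZd :=
  fun _ hd _ _ _ _ _ _ _ h0 hβ hℓs _ hWc hWdep _ hsupp _ hosc hosca _ hlip hlips hΛ hcol hR hc hc1 hrow _ hμ _ _ _ hF =>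
    RobustBall.HeatBathPoincareZd.su2_gibbsVariance_le_onBall_quarter hd h0 hβ hℓs hWc hWdep hsupp hosc hosca hlip hlips hΛ hcol hR hc hc1 hrow hμ hF



end V23J_rbp2_GibbsStateInequalities

/-! ### DEFAULT GROUPING (p2): one consolidating conjunction per owner file — `G_<tag> := T_a ∧ T_b ∧ …` + `_holds`.
The lead composes V23J by theme; p3 renames `G_<tag> ↦ T<k>_<Name>` (via --map) or regroups at will; these are additions, not owner bytes. -/
section V23J_groups

/-- Default group for section `V23J_ds1_HaarFourthCumulants`: the conjunction of its 3 owner texts. -/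
def T92_HaarFourthMomentsAndCumulants : Prop :=
  T92a_SUNHaarFourthMoments ∧ T92b_SUNCharacterFourthCumulant ∧ T92c_SU3ZeroCouplingFourthCumulant

/-- `T92_HaarFourthMomentsAndCumulants` holds (componentwise by the owners' `_holds`). -/
theorem T92_HaarFourthMomentsAndCumulants_holds : T92_HaarFourthMomentsAndCumulants :=
  ⟨T92a_SUNHaarFourthMoments_holds, T92b_SUNCharacterFourthCumulant_holds, T92c_SU3ZeroCouplingFourthCumulant_holds⟩

/-- Default group for section `V23J_ds3_StarSusceptibility`: the conjunction of its 4 owner texts. -/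
def T93_SU2WilsonStarSusceptibility : Prop :=
  T93a_SU2WilsonKernelSusceptibilityStar ∧ T93b_SU2WilsonKernelSusceptibilityStarLimit ∧ T93c_SU2WilsonKernelSusceptibilityStarRate ∧ T93d_SU2WilsonBoundaryStarGeometric

/-- `T93_SU2WilsonStarSusceptibility` holds (componentwise by the owners' `_holds`). -/
theorem T93_SU2WilsonStarSusceptibility_holds : T93_SU2WilsonStarSusceptibility :=
  ⟨T93a_SU2WilsonKernelSusceptibilityStar_holds, T93b_SU2WilsonKernelSusceptibilityStarLimit_holds, T93c_SU2WilsonKernelSusceptibilityStarRate_holds, T93d_SU2WilsonBoundaryStarGeometric_holds⟩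

/-- Default group for section `V23J_rbp2_GibbsStateInequalities`: the conjunction of its 5 owner texts. -/
def T94_SU2GibbsStateFunctionalInequalities : Prop :=
  T94a_SU2GibbsLangevinPoincareKR ∧ T94b_SU2GibbsLangevinPoincareDim3 ∧ T94c_SU2GibbsGlauberPoincareKR ∧ T94d_SU2GibbsExponentialConcentrationKR ∧ T94e_SU2GibbsGlauberPoincareOnBallZd

/-- `T94_SU2GibbsStateFunctionalInequalities` holds (componentwise by the owners' `_holds`). -/
theorem T94_SU2GibbsStateFunctionalInequalities_holds : T94_SU2GibbsStateFunctionalInequalities :=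
  ⟨T94a_SU2GibbsLangevinPoincareKR_holds, T94b_SU2GibbsLangevinPoincareDim3_holds, T94c_SU2GibbsGlauberPoincareKR_holds, T94d_SU2GibbsExponentialConcentrationKR_holds, T94e_SU2GibbsGlauberPoincareOnBallZd_holds⟩

end V23J_groups

end Summit.Ventures.YMGap

end
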